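import Summits.KontsevichZagierPeriods.Zeta5Search.Certificates.RecordRayDenominatorsWindows
import Summits.KontsevichZagierPeriods.Zeta5Search.RVFlatGaugeBeyondM1Lemmas
import HarnessLib

/-!
# ζ(5) search — the record ray's DENOMINATORS, V: exact valuations on the ray and the CELL CORE lemma (TYPER g15)

HONEST FRAMING: systematic search; no irrationality claim unless certified.

OUR work (Summit side; typer seat, generation 15).  Files I–IV removed, from the baseline multiplier `M0 = d⁹N♯N♯′/|ρ|`,
the prime powers certified by the BIG-PRIME laws (`θ = p/n > 16`).  Below `θ = 16` the tree's proved information on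
`v_p(P_n)` is the census ATLAS: typed `θ`-cells `A n < p ≤ B n` with a proved bound `B_cell ≤ v_p(Cas₇(bRec n))`
(`RecordAtlas.RecordCell*`, `ResidueLaw.RecWindowM*`, … — P1/p3/gen-2/typer machines).  This file turns any such cell
into a window of the multiplier:

* exact single-digit valuations on the ray for a prime `p` with `41n < p²`: `v_p((c·n)!) = ⌊cn/p⌋`
  (`padicValRat_factorial_eq_div`, via the tree's `RVFlatGauge.padicValNat_factorial_of_lt_sq`), hence `v_p(N♯(b))`, `v_p(N♯(b′))` (`padicValRat_sharpNormaliser_bRecord{,'}`,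
  for `p > n`, `p > 14`) and `v_p(ρ(a·n))` (`padicValRat_rhoOf_aRec`) as explicit sums of integer parts;
* `cell_core` — if `B ≤ v_p(Cas₇(b))`, then `p^k` divides the multiplied wedge `z_{W′}z_V − z_W z_{V′} = d⁹N♯N♯′·Cas₇`
  as soon as `k ≤ 9 + v_p(N♯) + v_p(N♯′) + B`, and the multiplied Q-minor `d⁵(z_U z_{W′} − z_{U′} z_W) = d⁹N♯N♯′·Q/ρ`
  as soon as `k ≤ 9 + v_p(N♯) + v_p(N♯′) − v_p(ρ)` (`Q(a·n) ∈ ℤ`).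

File VI instantiates it on fourteen record cells and lands the exponent `0.537`.  Valuation bookkeeping only.
-/

noncomputable section

open Finset Real Filter Topology

namespace Summit.KontsevichZagierPeriods.Zeta5Search.RecordRay

open Summit.KontsevichZagierPeriods.Zeta5Search.DualSeries
open Summit.KontsevichZagierPeriods.Zeta5Search.DualSeriesDenominators
open Summit.KontsevichZagierPeriods.Zeta5Search.WedgeDictionary
open Summit.KontsevichZagierPeriods.Zeta5Search.DualSeriesLemma19 (bRecord)
open Summit.KontsevichZagierPeriods.Zeta5Search.CasoratianValuation (casoratian shift)

/-! ### Single-digit Legendre -/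

/-- The rational form: `v_p((m! : ℚ)) = ⌊m/p⌋` for `m < p²`. -/
theorem padicValRat_factorial_eq_div {p m : ℕ} [hp : Fact p.Prime] (h : m < p ^ 2) :
    padicValRat p ((m.factorial : ℕ) : ℚ) = ((m / p : ℕ) : ℤ) := by
  rw [padicValRat.of_nat, RVFlatGauge.padicValNat_factorial_of_lt_sq h]

/-- `⌊(m−1)/p⌋ = ⌊m/p⌋` when `p ∤ m` (`m ≥ 1`). -/
theorem pred_div_eq {p m : ℕ} (hp : 0 < p) (hm : 1 ≤ m) (h : ¬ p ∣ m) : (m - 1) / p = m / p := by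
  have h1 := Nat.div_add_mod m p
  have h2 : m % p ≠ 0 := fun h0 => h (Nat.dvd_of_mod_eq_zero h0)
  have h3 := Nat.mod_lt m hp
  apply Nat.div_eq_of_lt_le
  · have : p * (m / p) ≤ m - 1 := by omega
    linarith [Nat.mul_comm p (m / p)]
  · have : m - 1 < p * (m / p) + p := by omega
    linarith [Nat.mul_comm p (m / p)]

/-- `v_p(|x|) = v_p(x)`. -/
theorem padicValRat_abs (p : ℕ) (x : ℚ) : padicValRat p |x| = padicValRat p x := by
  rcases abs_choice x with h | h
  · rw [h]
  · rw [h, padicValRat.neg]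

/-! ### Valuations of the normalisers and of `ρ` on the ray -/

section Prime3

variable {n p : ℕ}

/-- `v_p(N(bRecord n)) = ⌊12n/p⌋ + ⌊13n/p⌋ + ⌊14n/p⌋ + ⌊15n/p⌋ + ⌊14n/p⌋ + ⌊13n/p⌋` for `15n < p²`. -/
theorem padicValRat_normaliser_bRecord (hp : p.Prime) (hsq : 15 * n < p ^ 2) :
    padicValRat p ((normaliser (bRecord n) : ℕ) : ℚ) =
      ((12 * n / p + 13 * n / p + 14 * n / p + 15 * n / p + 14 * n / p + 13 * n / p : ℕ) : ℤ) := by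
  haveI := Fact.mk hp
  have hF : ∀ m : ℕ, ((m.factorial : ℕ) : ℚ) ≠ 0 := fun m => by exact_mod_cast (Nat.factorial_pos m).ne'
  rw [normaliser_bRecord]
  simp only [Nat.cast_mul]
  rw [padicValRat.mul (by simp [hF]) (hF _), padicValRat.mul (by simp [hF]) (hF _), padicValRat.mul (by simp [hF]) (hF _),
    padicValRat.mul (by simp [hF]) (hF _), padicValRat.mul (hF _) (hF _),
    padicValRat_factorial_eq_div (show 12 * n < p ^ 2 by omega), padicValRat_factorial_eq_div (show 13 * n < p ^ 2 by omega),
    padicValRat_factorial_eq_div (show 14 * n < p ^ 2 by omega), padicValRat_factorial_eq_div (show 15 * n < p ^ 2 by omega)]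
  simp only [Nat.cast_add]

/-- `v_p(N(bRecord' n))` has the same value for `p > n`, `p > 14` (then `p ∤ 13n, 14n`, so `⌊(13n−1)/p⌋ = ⌊13n/p⌋`,
`⌊(14n−1)/p⌋ = ⌊14n/p⌋`), `15n < p²`, `n ≥ 1`. -/
theorem padicValRat_normaliser_bRecord' (hn : 1 ≤ n) (hp : p.Prime) (hnp : n < p) (hp14 : 14 < p) (hsq : 15 * n < p ^ 2) :
    padicValRat p ((normaliser (bRecord' n) : ℕ) : ℚ) =
      ((12 * n / p + 13 * n / p + 14 * n / p + 15 * n / p + 14 * n / p + 13 * n / p : ℕ) : ℤ) := by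
  haveI := Fact.mk hp
  have hF : ∀ m : ℕ, ((m.factorial : ℕ) : ℚ) ≠ 0 := fun m => by exact_mod_cast (Nat.factorial_pos m).ne'
  have hnd : ¬ p ∣ n := fun h => absurd (Nat.le_of_dvd (by omega) h) (by omega)
  have h13 : ¬ p ∣ 13 * n := by
    intro h
    rcases (Nat.Prime.dvd_mul hp).1 h with h' | h'
    · exact absurd (Nat.le_of_dvd (by norm_num) h') (by omega)
    · exact hnd h'
  have h14 : ¬ p ∣ 14 * n := by
    intro h
    rcases (Nat.Prime.dvd_mul hp).1 h with h' | h'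
    · exact absurd (Nat.le_of_dvd (by norm_num) h') (by omega)
    · exact hnd h'
  have e13 : (13 * n - 1) / p = 13 * n / p := pred_div_eq hp.pos (by omega) h13
  have e14 : (14 * n - 1) / p = 14 * n / p := pred_div_eq hp.pos (by omega) h14
  rw [normaliser_bRecord']
  simp only [Nat.cast_mul]
  rw [padicValRat.mul (by simp [hF]) (hF _), padicValRat.mul (by simp [hF]) (hF _), padicValRat.mul (by simp [hF]) (hF _),
    padicValRat.mul (by simp [hF]) (hF _), padicValRat.mul (hF _) (hF _),
    padicValRat_factorial_eq_div (show 12 * n < p ^ 2 by omega), padicValRat_factorial_eq_div (show 13 * n - 1 < p ^ 2 by omega),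
    padicValRat_factorial_eq_div (show 14 * n - 1 < p ^ 2 by omega), padicValRat_factorial_eq_div (show 15 * n < p ^ 2 by omega),
    padicValRat_factorial_eq_div (show 14 * n < p ^ 2 by omega), padicValRat_factorial_eq_div (show 13 * n < p ^ 2 by omega),
    e13, e14]
  simp only [Nat.cast_add]

/-- `v_p(N♯(bRecord n)) = v_p(N(bRecord n)) − ⌊16n/p⌋ − ⌊15n/p⌋` (`16n < p²`). -/
theorem padicValRat_sharpNormaliser_bRecord (hp : p.Prime) (hsq : 16 * n < p ^ 2) :
    padicValRat p (sharpNormaliser (bRecord n)) =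
      ((12 * n / p + 13 * n / p + 14 * n / p + 15 * n / p + 14 * n / p + 13 * n / p : ℕ) : ℤ)
        - ((16 * n / p : ℕ) : ℤ) - ((15 * n / p : ℕ) : ℤ) := by
  haveI := Fact.mk hp
  have hF : ∀ m : ℕ, ((m.factorial : ℕ) : ℚ) ≠ 0 := fun m => by exact_mod_cast (Nat.factorial_pos m).ne'
  have hN : ((normaliser (bRecord n) : ℕ) : ℚ) ≠ 0 := by
    have : 0 < normaliser (bRecord n) := by unfold normaliser; exact prod_pos fun s _ => Nat.factorial_pos _
    exact_mod_cast this.ne'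
  unfold sharpNormaliser
  rw [bn_bRecord_slot n (by norm_num) (by norm_num), bn_bRecord_slot n (by norm_num) (by norm_num),
    padicValRat.div hN (mul_ne_zero (hF _) (hF _)), padicValRat.mul (hF _) (hF _),
    padicValRat_normaliser_bRecord hp (by omega), padicValRat_factorial_eq_div (by omega),
    padicValRat_factorial_eq_div (by omega)]
  norm_num
  ring

/-- `v_p(N♯(bRecord' n))` has the same value (`p > n`, `p > 14`, `16n < p²`). -/
theorem padicValRat_sharpNormaliser_bRecord' (hn : 1 ≤ n) (hp : p.Prime) (hnp : n < p) (hp14 : 14 < p) (hsq : 16 * n < p ^ 2) :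
    padicValRat p (sharpNormaliser (bRecord' n)) =
      ((12 * n / p + 13 * n / p + 14 * n / p + 15 * n / p + 14 * n / p + 13 * n / p : ℕ) : ℤ)
        - ((16 * n / p : ℕ) : ℤ) - ((15 * n / p : ℕ) : ℤ) := by
  haveI := Fact.mk hp
  have hF : ∀ m : ℕ, ((m.factorial : ℕ) : ℚ) ≠ 0 := fun m => by exact_mod_cast (Nat.factorial_pos m).ne'
  have hN : ((normaliser (bRecord' n) : ℕ) : ℚ) ≠ 0 := by
    have : 0 < normaliser (bRecord' n) := by unfold normaliser; exact prod_pos fun s _ => Nat.factorial_pos _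
    exact_mod_cast this.ne'
  unfold sharpNormaliser
  rw [bn_bRecord'_slot n (by norm_num) (by norm_num), bn_bRecord'_slot n (by norm_num) (by norm_num),
    padicValRat.div hN (mul_ne_zero (hF _) (hF _)), padicValRat.mul (hF _) (hF _),
    padicValRat_normaliser_bRecord' hn hp hnp hp14 (by omega), padicValRat_factorial_eq_div (by omega),
    padicValRat_factorial_eq_div (by omega)]
  norm_num
  ring

/-- `|ρ(a·n)|` in factorials, over `ℚ`. -/
theorem abs_rhoOf_aRec_rat (n : ℕ) :
    |rhoOf (aRec n)| = ((((8 * n).factorial : ℕ) : ℚ) * (((9 * n).factorial : ℕ) : ℚ) * (((10 * n).factorial : ℕ) : ℚ) *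
      (((11 * n).factorial : ℕ) : ℚ) * (((10 * n).factorial : ℕ) : ℚ) * (((11 * n).factorial : ℕ) : ℚ) *
      (((12 * n).factorial : ℕ) : ℚ) * (((13 * n).factorial : ℕ) : ℚ) * (((12 * n).factorial : ℕ) : ℚ) *
      (((14 * n).factorial : ℕ) : ℚ) * (((15 * n).factorial : ℕ) : ℚ) * (((16 * n).factorial : ℕ) : ℚ) *
      (((16 * n).factorial : ℕ) : ℚ) * (((17 * n).factorial : ℕ) : ℚ) * (((18 * n).factorial : ℕ) : ℚ)) /
      (4 * ((((17 * n).factorial : ℕ) : ℚ) * (((14 * n).factorial : ℕ) : ℚ) * (((13 * n).factorial : ℕ) : ℚ) *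
        (((12 * n).factorial : ℕ) : ℚ) * (((11 * n).factorial : ℕ) : ℚ)) * (((25 * n).factorial : ℕ) : ℚ)) := by
  have h := abs_rhoOf_aRec n
  apply Rat.cast_injective (α := ℝ)
  simp only [Rat.cast_abs, Rat.cast_div, Rat.cast_mul, Rat.cast_natCast, Rat.cast_ofNat]
  exact h

/-- `v_p(ρ(a·n))` for `25n < p²`, `p` odd: the fifteen numerator minus the six denominator integer parts. -/
theorem padicValRat_rhoOf_aRec (hp : p.Prime) (hp2 : p ≠ 2) (hsq : 25 * n < p ^ 2) :
    padicValRat p (rhoOf (aRec n)) =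
      ((8 * n / p + 9 * n / p + 10 * n / p + 11 * n / p + 10 * n / p + 11 * n / p + 12 * n / p + 13 * n / p +
          12 * n / p + 14 * n / p + 15 * n / p + 16 * n / p + 16 * n / p + 17 * n / p + 18 * n / p : ℕ) : ℤ)
        - ((17 * n / p + 14 * n / p + 13 * n / p + 12 * n / p + 11 * n / p + 25 * n / p : ℕ) : ℤ) := by
  haveI := Fact.mk hp
  have hF : ∀ m : ℕ, ((m.factorial : ℕ) : ℚ) ≠ 0 := fun m => by exact_mod_cast (Nat.factorial_pos m).ne'
  have h4 : padicValRat p (4 : ℚ) = 0 := by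
    rw [show (4 : ℚ) = ((4 : ℕ) : ℚ) by norm_num, padicValRat.of_nat]
    have : ¬ p ∣ 4 := by
      intro h
      have := (Nat.prime_dvd_prime_iff_eq hp Nat.prime_two).1 (hp.dvd_of_dvd_pow (show p ∣ 2 ^ 2 by norm_num; exact h))
      exact hp2 this
    exact_mod_cast padicValNat.eq_zero_of_not_dvd this
  rw [← padicValRat_abs, abs_rhoOf_aRec_rat]
  rw [padicValRat.div (by simp [hF]) (by simp [hF])]
  simp only [padicValRat.mul, hF, mul_ne_zero_iff, ne_eq, not_false_eq_true, and_self, OfNat.ofNat_ne_zero, h4,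
    padicValRat_factorial_eq_div (p := p) (show 8 * n < p ^ 2 by omega),
    padicValRat_factorial_eq_div (p := p) (show 9 * n < p ^ 2 by omega),
    padicValRat_factorial_eq_div (p := p) (show 10 * n < p ^ 2 by omega),
    padicValRat_factorial_eq_div (p := p) (show 11 * n < p ^ 2 by omega),
    padicValRat_factorial_eq_div (p := p) (show 12 * n < p ^ 2 by omega),
    padicValRat_factorial_eq_div (p := p) (show 13 * n < p ^ 2 by omega),
    padicValRat_factorial_eq_div (p := p) (show 14 * n < p ^ 2 by omega),
    padicValRat_factorial_eq_div (p := p) (show 15 * n < p ^ 2 by omega),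
    padicValRat_factorial_eq_div (p := p) (show 16 * n < p ^ 2 by omega),
    padicValRat_factorial_eq_div (p := p) (show 17 * n < p ^ 2 by omega),
    padicValRat_factorial_eq_div (p := p) (show 18 * n < p ^ 2 by omega),
    padicValRat_factorial_eq_div (p := p) (show 25 * n < p ^ 2 by omega)]
  push_cast; ring

/-! ### The cell core -/

/-- **CELL CORE.**  For a prime `p` with `n < p ≤ 41n`, `41n < p²`: if `B ≤ v_p(Cas₇(bRecord n))` (an atlas cell),
`v_p(N♯(b)) = vN`, `v_p(N♯(b′)) = vN'`, `v_p(ρ(a·n)) = vr`, and `k ≤ 9 + vN + vN' + B`, `k ≤ 9 + vN + vN' − vr`, then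
`p^k` divides the multiplied wedge `z_{W′}z_V − z_W z_{V′}` and the multiplied Q-minor `d⁵(z_U z_{W′} − z_{U′} z_W)`. -/
theorem cell_core (hn : 1 ≤ n) (hp : p.Prime) (hp41 : p ≤ 41 * n) (hsq : 41 * n < p ^ 2)
    {vN vN' vr B : ℤ} (hvN : padicValRat p (sharpNormaliser (bRecord n)) = vN)
    (hvN' : padicValRat p (sharpNormaliser (bRecord' n)) = vN') (hvr : padicValRat p (rhoOf (aRec n)) = vr)
    (hcas : casoratian (bRecord n) 7 ≠ 0 → B ≤ padicValRat p (casoratian (bRecord n) 7))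
    {k : ℕ} (hk : (k : ℤ) ≤ 9 + vN + vN' + B) (hkq : (k : ℤ) ≤ 9 + vN + vN' - vr)
    {zW zV zW' zV' zU zU' : ℤ}
    (hzW : dRec n ^ 3 * sharpNormaliser (bRecord n) * coeffW (bRecord n) = zW)
    (hzV : dRec n ^ 6 * sharpNormaliser (bRecord n) * coeffV (bRecord n) = zV)
    (hzW' : dRec n ^ 3 * sharpNormaliser (bRecord' n) * coeffW (bRecord' n) = zW')
    (hzV' : dRec n ^ 6 * sharpNormaliser (bRecord' n) * coeffV (bRecord' n) = zV')
    (hzU : dRec n * sharpNormaliser (bRecord n) * coeffU (bRecord n) = zU)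
    (hzU' : dRec n * sharpNormaliser (bRecord' n) * coeffU (bRecord' n) = zU') :
    (p : ℤ) ^ k ∣ (zW' * zV - zW * zV') ∧
    (p : ℤ) ^ k ∣ ((Nat.lcmUpto (41 * n) : ℤ) ^ 5 * (zU * zW') - (Nat.lcmUpto (41 * n) : ℤ) ^ 5 * (zU' * zW)) := by
  haveI := Fact.mk hp
  have hd : dRec n ≠ 0 := (dRec_pos n).ne'
  have hN : sharpNormaliser (bRecord n) ≠ 0 := (sharpNormaliser_pos _).ne'
  have hN' : sharpNormaliser (bRecord' n) ≠ 0 := (sharpNormaliser_pos _).ne'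
  have hdv : padicValRat p (dRec n) = 1 := by
    unfold dRec; rw [padicValRat.of_nat]
    exact_mod_cast Literature.NumberTheory.Transcendental.Zudilin2004.padicValNat_lcmUpto_eq_one hp41 hsq
  constructor
  · -- the wedge: z_{W'} z_V − z_W z_{V'} = d⁹ N♯ N♯' · Cas₇
    have hid : ((zW' * zV - zW * zV' : ℤ) : ℚ) =
        dRec n ^ 9 * sharpNormaliser (bRecord n) * sharpNormaliser (bRecord' n) * casoratian (bRecord n) 7 := by
      push_cast
      rw [← hzW, ← hzV, ← hzW', ← hzV']
      unfold casoratian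
      rw [← bRecord'_eq_shift]
      ring
    by_cases h0 : casoratian (bRecord n) 7 = 0
    · have : (zW' * zV - zW * zV' : ℤ) = 0 := by
        have := hid; rw [h0, mul_zero] at this; exact_mod_cast this
      rw [this]; exact dvd_zero _
    rw [padicValInt_dvd_iff]; right
    have hval : ((padicValInt p (zW' * zV - zW * zV') : ℕ) : ℤ) = 9 + vN + vN' + padicValRat p (casoratian (bRecord n) 7) := by
      rw [← padicValRat.of_int, hid, padicValRat.mul (mul_ne_zero (mul_ne_zero (pow_ne_zero _ hd) hN) hN') h0,
        padicValRat.mul (mul_ne_zero (pow_ne_zero _ hd) hN) hN', padicValRat.mul (pow_ne_zero _ hd) hN,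
        padicValRat.pow, hdv, hvN, hvN']
      ring
    have := hcas h0
    have : (k : ℤ) ≤ ((padicValInt p (zW' * zV - zW * zV') : ℕ) : ℤ) := by rw [hval]; linarith
    exact_mod_cast this
  · -- the Q-minor: d⁵ (z_U z_{W'} − z_{U'} z_W) = d⁹ N♯ N♯' · Q / ρ
    have hρ : rhoOf (aRec n) ≠ 0 := rhoOf_aRec_ne_zero n
    have hQ0 : (recordQ n : ℚ) ≠ 0 := by
      have := abs_recordQ_pos n
      have h' : recordQ n ≠ 0 := by intro h; rw [h] at this; simp at this
      exact_mod_cast h'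
    have hD : ((Nat.lcmUpto (41 * n) : ℕ) : ℚ) = dRec n := rfl
    have hid : (((Nat.lcmUpto (41 * n) : ℤ) ^ 5 * (zU * zW') - (Nat.lcmUpto (41 * n) : ℤ) ^ 5 * (zU' * zW) : ℤ) : ℚ) =
        dRec n ^ 9 * sharpNormaliser (bRecord n) * sharpNormaliser (bRecord' n) * ((recordQ n : ℚ) / rhoOf (aRec n)) := by
      push_cast
      rw [hD, ← hzU, ← hzW', ← hzU', ← hzW, recordQ_eq_wedge hn]
      field_simp
    rw [padicValInt_dvd_iff]; right
    have hval : ((padicValInt p ((Nat.lcmUpto (41 * n) : ℤ) ^ 5 * (zU * zW') -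
        (Nat.lcmUpto (41 * n) : ℤ) ^ 5 * (zU' * zW)) : ℕ) : ℤ) = 9 + vN + vN' + (padicValRat p (recordQ n : ℚ) - vr) := by
      rw [← padicValRat.of_int, hid, padicValRat.mul (mul_ne_zero (mul_ne_zero (pow_ne_zero _ hd) hN) hN') (div_ne_zero hQ0 hρ),
        padicValRat.mul (mul_ne_zero (pow_ne_zero _ hd) hN) hN', padicValRat.mul (pow_ne_zero _ hd) hN,
        padicValRat.pow, hdv, hvN, hvN', padicValRat.div hQ0 hρ, hvr]
      ring
    have hQv : 0 ≤ padicValRat p (recordQ n : ℚ) := by rw [padicValRat.of_int]; positivity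
    have : (k : ℤ) ≤ ((padicValInt p ((Nat.lcmUpto (41 * n) : ℤ) ^ 5 * (zU * zW') -
        (Nat.lcmUpto (41 * n) : ℤ) ^ 5 * (zU' * zW)) : ℕ) : ℤ) := by rw [hval]; linarith
    exact_mod_cast this

end Prime3

end Summit.KontsevichZagierPeriods.Zeta5Search.RecordRay
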